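import Summits.AtomisticToContinuum.FouriersLaw.Theorems.OddSectorIrreversibilityOddCorrectorDecayPointwiseBound
import Summits.AtomisticToContinuum.FouriersLaw.Theorems.OddSectorIrreversibilityOddCorrectorDecayExpectationTools
import Summits.AtomisticToContinuum.FouriersLaw.Theorems.OddSectorIrreversibilityOddCorrectorDecayWeightMoments

/-!
# The bath-locality estimate, I: the expectation of the pointwise bound

Support file for item `stmt-AtomisticToContinuum-9139` (`OddSectorIrreversibility.OddCorrectorDecay`), negative
side. Integrating the pointwise bound `ChainVariation.sq_currentDiff_le_pointwise` against
`ν = μ_T ⊗ P` (Gibbs weight times the law of the Brownian pair) and transporting each term to a static Gibbs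
integral (`Transport`: stationarity of the open chain, Liouville for the closed chain, Brownian sixth moments;
Tonelli in time) gives, for `0 < t ≤ t₀`, `s > 0` and `κ ≥ 4+24β, 144β, 6t₀(3lam+48β)`:
`∫ (J(z_t) - J(y_t))² dν ≤ s³ A₁ ∫ Ψ_κ dμ_T + (A₂/s⁶) μ_T(univ)` (`lintegral_sq_currentDiff_le`) with
`A₁ = (2432 + 2e^{6t₀(ω₂+4)})/3` and an explicit `A₂(t₀, T, γ)`: the one-site sum carries the factor `N`
(`WeightMoments.exists_const_lintegral_oneSiteSum_le`), the forcing does not.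
-/

noncomputable section

open MeasureTheory ProbabilityTheory Filter Topology Set Function Finset intervalIntegral
open scoped NNReal ENNReal
open Literature.Probability.Process
open Literature.MathematicalPhysics.KineticTheory Literature.MathematicalPhysics.KineticTheory.HeatConduction
open Literature.MathematicalPhysics.KineticTheory.OddSectorLocality
open OscillatorChain (bathWeight)
open Summit.AtomisticToContinuum.FouriersLaw.Theorems.ChainVariation

namespace Summit.AtomisticToContinuum.FouriersLaw.Theorems.OddCorrectorBathLocality

/-! ### The expectation of the pointwise bound -/

section Expectation

variable {ω₂ lam β γ T : ℝ} (hω : 0 < ω₂) (hl : 0 < lam) (hβ : 0 ≤ β) (hγ : 0 ≤ γ) {N : ℕ} (hN : 0 < N)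
  (hT : 0 < T)
include hω hl hβ hγ hN hT

/-- **Expectation of the pointwise bound** (see the module docstring): for `0 < t ≤ t₀`, `s > 0`,
`κ ≥ 4+24β, 144β, 6t₀(3lam+48β)`,
`∫ (J(z_t(x,ω)) - J(y_t(x)))² d(μ_T ⊗ P) ≤ s³A₁ ∫Ψ_κ dμ_T + (A₂/s⁶) μ_T(univ)`. [folklore] -/
theorem lintegral_sq_currentDiff_le {t t₀ s κ : ℝ} (ht : 0 < t) (htt : t ≤ t₀) (hs : 0 < s)
    (hκ₁ : 4 + 24 * β ≤ κ) (hκ₂ : 144 * β ≤ κ) (hκ₃ : 6 * t₀ * (3 * lam + 48 * β) ≤ κ) :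
    ∫⁻ p, ENNReal.ofReal (((∑ i, (pinnedChain ω₂ lam β γ).bondCurrent N i ((pinnedChain ω₂ lam β γ).chainFlow N p.1 (chainNoise N (Real.sqrt (2 * (pinnedChain ω₂ lam β γ).γ * T)) (Real.sqrt (2 * (pinnedChain ω₂ lam β γ).γ * T)) (pairPath p.2)) t)) -
        (∑ i, (pinnedChain ω₂ lam β γ).bondCurrent N i ((pinnedChain ω₂ lam β 0).chainFlow N p.1 0 t))) ^ 2) ∂((gibbsWeight ω₂ lam β γ T N).prod wienerPair) ≤
      ENNReal.ofReal (s ^ 3 * ((2 * 1216 + 2 * Real.exp (6 * t₀ * (ω₂ + 4))) / 3)) *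
          (∫⁻ x, ENNReal.ofReal (∑ i, (Real.exp (κ * (x.1 i) ^ 2) + (x.2 i) ^ 12 + 1)) ∂(gibbsWeight ω₂ lam β γ T N)) +
        ENNReal.ofReal (((32768 * (Real.sqrt (2 * (pinnedChain ω₂ lam β γ).γ * T)) ^ 6 * (2880 * Real.exp (t₀ / 2)) + 32768 * t₀ ^ 5 * (Real.sqrt (2 * (pinnedChain ω₂ lam β γ).γ * T)) ^ 6 * ((2880 * Real.exp (t₀ / 2)) * t₀) +
          1048576 * γ ^ 6 * t₀ ^ 5 * (1 + t₀ ^ 6) * (1440 * T ^ 3 * t₀)) / 3) / s ^ 6) *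
          ((gibbsWeight ω₂ lam β γ T N) univ) := by
  set μ : Measure (PhaseSpace N) := (gibbsWeight ω₂ lam β γ T N) with hμ
  haveI : SFinite μ := by rw [hμ]; unfold gibbsWeight; infer_instance
  set P := (pinnedChain ω₂ lam β γ) with hP
  set c : ℝ := Real.sqrt (2 * P.γ * T) with hc
  have ht0 : 0 ≤ t₀ := ht.le.trans htt
  -- the trajectories as functions of `p = (x, ω)`
  set z : ℝ → PhaseSpace N × WienerPair → PhaseSpace N :=
    fun τ p => P.chainFlow N p.1 (chainNoise N c c (pairPath p.2)) τ with hz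
  set y : ℝ → PhaseSpace N × WienerPair → PhaseSpace N :=
    fun τ p => (pinnedChain ω₂ lam β 0).chainFlow N p.1 0 τ with hy
  set Ψ : PhaseSpace N → ℝ := fun v => ∑ i, (Real.exp (κ * (v.1 i) ^ 2) + (v.2 i) ^ 12 + 1) with hΨ
  have hΨc : Continuous Ψ := by rw [hΨ]; fun_prop
  have hΨm : Measurable Ψ := hΨc.measurable
  have hΨ0 : ∀ v, 0 ≤ Ψ v := fun v => Finset.sum_nonneg fun i _ => by positivity
  -- measurability
  have hzm : ∀ τ, Measurable (z τ) := fun τ => by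
    have h := pinnedChain_measurable_solMap_pairPath hω hl.le hβ hγ N T T τ
    exact h
  have hzjm : Measurable fun q : ℝ × (PhaseSpace N × WienerPair) => z q.1 q.2 := by
    have h := measurable_solMap_pairPath_uncurry hω hl.le hβ hγ (N := N) T T
    exact h
  have hym : ∀ τ, Measurable (y τ) := fun τ => by
    have h0 : Continuous (0 : ℝ → Fin N → ℝ) := continuous_const
    exact (pinnedChain_continuous_chainFlow_left hω hl.le hβ le_rfl N h0 τ).measurable.comp measurable_fst
  have hyjm : Measurable fun q : ℝ × (PhaseSpace N × WienerPair) => y q.1 q.2 := by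
    have h := (measurable_closedFlow_uncurry hω hl.le hβ (N := N)).comp
      (measurable_fst.prodMk (measurable_fst.comp measurable_snd) :
        Measurable fun q : ℝ × (PhaseSpace N × WienerPair) => (q.1, q.2.1))
    exact h
  have hBm : ∀ (u : ℝ), Measurable (fun p : PhaseSpace N × WienerPair => brownian u.toNNReal p.2.1) ∧
      Measurable (fun p : PhaseSpace N × WienerPair => brownian u.toNNReal p.2.2) := fun u =>
    ⟨(measurable_brownian _).comp (measurable_fst.comp measurable_snd),
     (measurable_brownian _).comp (measurable_snd.comp measurable_snd)⟩
  have hBjm : Measurable (fun q : ℝ × (PhaseSpace N × WienerPair) => brownian q.1.toNNReal q.2.2.1) ∧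
      Measurable (fun q : ℝ × (PhaseSpace N × WienerPair) => brownian q.1.toNNReal q.2.2.2) := by
    constructor
    · exact measurable_brownian_toNNReal_uncurry.comp
        (measurable_fst.prodMk (measurable_fst.comp (measurable_snd.comp measurable_snd)))
    · exact measurable_brownian_toNNReal_uncurry.comp
        (measurable_fst.prodMk (measurable_snd.comp (measurable_snd.comp measurable_snd)))
  -- continuity in time, path by path
  have hzc : ∀ p : PhaseSpace N × WienerPair, Continuous fun τ => z τ p := fun p =>
    pinnedChain_continuous_chainFlow hω hl.le hβ hγ N p.1 (continuous_chainNoise _ _ _)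
  have hyc : ∀ p : PhaseSpace N × WienerPair, Continuous fun τ => y τ p := fun p => by
    have h0 : Continuous (0 : ℝ → Fin N → ℝ) := continuous_const
    exact pinnedChain_continuous_chainFlow hω hl.le hβ le_rfl N p.1 h0
  have hBc : ∀ p : PhaseSpace N × WienerPair, (Continuous fun u : ℝ => brownian u.toNNReal p.2.1) ∧
      Continuous fun u : ℝ => brownian u.toNNReal p.2.2 := fun p =>
    ⟨(continuous_brownian p.2.1).comp continuous_real_toNNReal,
     (continuous_brownian p.2.2).comp continuous_real_toNNReal⟩
  -- the five integrands
  set F₁ : PhaseSpace N × WienerPair → ℝ≥0∞ := fun p => ENNReal.ofReal (Ψ (z t p) + Ψ (y t p)) with hF₁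
  set F₂ : ℝ × (PhaseSpace N × WienerPair) → ℝ≥0∞ :=
    fun q => ENNReal.ofReal (Real.exp (6 * t₀ * (ω₂ + 4)) * (Ψ (z q.1 q.2) + Ψ (y q.1 q.2))) with hF₂
  set F₃ : PhaseSpace N × WienerPair → ℝ≥0∞ :=
    fun p => ENNReal.ofReal (|brownian t.toNNReal p.2.1| ^ 6 + |brownian t.toNNReal p.2.2| ^ 6) with hF₃
  set F₄ : ℝ × (PhaseSpace N × WienerPair) → ℝ≥0∞ :=
    fun q => ENNReal.ofReal (|brownian q.1.toNNReal q.2.2.1| ^ 6 + |brownian q.1.toNNReal q.2.2.2| ^ 6) with hF₄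
  set F₅ : ℝ × (PhaseSpace N × WienerPair) → ℝ≥0∞ :=
    fun q => ENNReal.ofReal ((z q.1 q.2).2 ⟨0, hN⟩ ^ 6 + (z q.1 q.2).2 ⟨N - 1, by omega⟩ ^ 6) with hF₅
  have hF₁m : Measurable F₁ := ((hΨm.comp (hzm t)).add (hΨm.comp (hym t))).ennreal_ofReal
  have hF₂m : Measurable F₂ := (measurable_const.mul ((hΨm.comp hzjm).add (hΨm.comp hyjm))).ennreal_ofReal
  have hF₃m : Measurable F₃ := by
    obtain ⟨h1, h2⟩ := hBm t
    exact ((h1.abs.pow_const 6).add (h2.abs.pow_const 6)).ennreal_ofReal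
  have hF₄m : Measurable F₄ := ((hBjm.1.abs.pow_const 6).add (hBjm.2.abs.pow_const 6)).ennreal_ofReal
  have hF₅m : Measurable F₅ :=
    ((((measurable_pi_apply _).comp (measurable_snd.comp hzjm)).pow_const 6).add
      (((measurable_pi_apply _).comp (measurable_snd.comp hzjm)).pow_const 6)).ennreal_ofReal
  -- expectations of the five integrands
  set IΨ : ℝ≥0∞ := ∫⁻ x, ENNReal.ofReal (Ψ x) ∂μ with hIΨ
  set Z : ℝ≥0∞ := μ univ with hZ
  have hΨsplit : ∀ (τ : ℝ), 0 ≤ τ → ∫⁻ p, ENNReal.ofReal (Ψ (z τ p) + Ψ (y τ p)) ∂(μ.prod wienerPair) = IΨ + IΨ := by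
    intro τ hτ
    have e : (fun p : PhaseSpace N × WienerPair => ENNReal.ofReal (Ψ (z τ p) + Ψ (y τ p))) =
        fun p => ENNReal.ofReal (Ψ (z τ p)) + ENNReal.ofReal (Ψ (y τ p)) := by
      funext p; rw [ENNReal.ofReal_add (hΨ0 _) (hΨ0 _)]
    have hm1 : Measurable fun p : PhaseSpace N × WienerPair => ENNReal.ofReal (Ψ (z τ p)) :=
      (hΨm.comp (hzm τ)).ennreal_ofReal
    rw [e, lintegral_add_left hm1]
    have h1 : ∫⁻ p, ENNReal.ofReal (Ψ (z τ p)) ∂(μ.prod wienerPair) = IΨ := by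
      have h := lintegral_prod_solMap_eq hω hl.le hβ hγ hN hT hτ hΨm.ennreal_ofReal
      exact h
    have h2 : ∫⁻ p, ENNReal.ofReal (Ψ (y τ p)) ∂(μ.prod wienerPair) = IΨ :=
      lintegral_prod_closedFlow_eq hω hl.le hβ hN γ T hτ hΨm.ennreal_ofReal
    rw [h1, h2]
  have hE₁ : ∫⁻ p, F₁ p ∂(μ.prod wienerPair) = IΨ + IΨ := hΨsplit t ht.le
  have hE₂ : ∀ τ ∈ Ioc (0:ℝ) t, ∫⁻ p, F₂ (τ, p) ∂(μ.prod wienerPair) ≤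
      ENNReal.ofReal (Real.exp (6 * t₀ * (ω₂ + 4))) * (IΨ + IΨ) := by
    intro τ hτ
    have e : (fun p : PhaseSpace N × WienerPair => F₂ (τ, p)) =
        fun p => ENNReal.ofReal (Real.exp (6 * t₀ * (ω₂ + 4))) * ENNReal.ofReal (Ψ (z τ p) + Ψ (y τ p)) := by
      funext p; simp only [hF₂]; rw [ENNReal.ofReal_mul (Real.exp_pos _).le]
    have hm2 : Measurable fun p : PhaseSpace N × WienerPair => ENNReal.ofReal (Ψ (z τ p) + Ψ (y τ p)) :=
      ((hΨm.comp (hzm τ)).add (hΨm.comp (hym τ))).ennreal_ofReal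
    rw [e, lintegral_const_mul _ hm2, hΨsplit τ hτ.1.le]
  have hm : ∀ (u : ℝ), 0 ≤ u → u ≤ t₀ →
      ENNReal.ofReal (1440 * Real.exp (u.toNNReal / 2)) ≤ ENNReal.ofReal (1440 * Real.exp (t₀ / 2)) := by
    intro u hu hut
    refine ENNReal.ofReal_le_ofReal (mul_le_mul_of_nonneg_left (Real.exp_le_exp.2 ?_) (by norm_num))
    rw [Real.coe_toNNReal u hu]; linarith
  have hE₃' : ∀ (u : ℝ), 0 ≤ u → u ≤ t₀ →
      ∫⁻ p, ENNReal.ofReal (|brownian u.toNNReal p.2.1| ^ 6 + |brownian u.toNNReal p.2.2| ^ 6) ∂(μ.prod wienerPair) ≤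
        ENNReal.ofReal (2880 * Real.exp (t₀ / 2)) * Z := by
    intro u hu hut
    obtain ⟨h1m, h2m⟩ := hBm u
    have e : (fun p : PhaseSpace N × WienerPair =>
        ENNReal.ofReal (|brownian u.toNNReal p.2.1| ^ 6 + |brownian u.toNNReal p.2.2| ^ 6)) =
        fun p => ENNReal.ofReal (|brownian u.toNNReal p.2.1| ^ 6) + ENNReal.ofReal (|brownian u.toNNReal p.2.2| ^ 6) := by
      funext p; rw [ENNReal.ofReal_add (by positivity) (by positivity)]
    have hm3 : Measurable fun p : PhaseSpace N × WienerPair => ENNReal.ofReal (|brownian u.toNNReal p.2.1| ^ 6) :=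
      (h1m.abs.pow_const 6).ennreal_ofReal
    rw [e, lintegral_add_left hm3]
    have h1 := (lintegral_prod_abs_brownian_fst_pow_six_le (ω₂ := ω₂) (lam := lam) (β := β) (γ := γ) (N := N)
      T u.toNNReal).trans (mul_le_mul_left (hm u hu hut) _)
    have h2 := (lintegral_prod_abs_brownian_snd_pow_six_le (ω₂ := ω₂) (lam := lam) (β := β) (γ := γ) (N := N)
      T u.toNNReal).trans (mul_le_mul_left (hm u hu hut) _)
    calc _ ≤ ENNReal.ofReal (1440 * Real.exp (t₀ / 2)) * Z + ENNReal.ofReal (1440 * Real.exp (t₀ / 2)) * Z :=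
          add_le_add h1 h2
      _ = ENNReal.ofReal (2880 * Real.exp (t₀ / 2)) * Z := by
          rw [← add_mul, ← ENNReal.ofReal_add (by positivity) (by positivity)]; ring_nf
  have hE₃ : ∫⁻ p, F₃ p ∂(μ.prod wienerPair) ≤ ENNReal.ofReal (2880 * Real.exp (t₀ / 2)) * Z := hE₃' t ht.le htt
  have hE₄ : ∀ u ∈ Ioc (0:ℝ) t, ∫⁻ p, F₄ (u, p) ∂(μ.prod wienerPair) ≤ ENNReal.ofReal (2880 * Real.exp (t₀ / 2)) * Z :=
    fun u hu => hE₃' u hu.1.le (hu.2.trans htt)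
  have hE₅ : ∀ v ∈ Ioc (0:ℝ) t, ∫⁻ p, F₅ (v, p) ∂(μ.prod wienerPair) ≤ ENNReal.ofReal (1440 * T ^ 3) * Z := by
    intro v hv
    have e : (fun p : PhaseSpace N × WienerPair => F₅ (v, p)) =
        fun p => ENNReal.ofReal ((z v p).2 ⟨0, hN⟩ ^ (2 * 3)) + ENNReal.ofReal ((z v p).2 ⟨N - 1, by omega⟩ ^ (2 * 3)) := by
      funext p; simp only [hF₅]; rw [ENNReal.ofReal_add (by positivity) (by positivity)]
    have hmi : ∀ i : Fin N, Measurable fun p : PhaseSpace N × WienerPair => ENNReal.ofReal ((z v p).2 i ^ (2 * 3)) :=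
      fun i => (((measurable_pi_apply i).comp (measurable_snd.comp (hzm v))).pow_const _).ennreal_ofReal
    rw [e, lintegral_add_left (hmi _)]
    have hst : ∀ i : Fin N, ∫⁻ p, ENNReal.ofReal ((z v p).2 i ^ (2 * 3)) ∂(μ.prod wienerPair) ≤
        ENNReal.ofReal (720 * T ^ 3) * Z := by
      intro i
      have hg : Measurable fun w : PhaseSpace N => ENNReal.ofReal (w.2 i ^ (2 * 3)) :=
        (((measurable_pi_apply i).comp measurable_snd).pow_const _).ennreal_ofReal
      have h := lintegral_prod_solMap_eq hω hl.le hβ hγ hN hT hv.1.le hg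
      have h' : ∫⁻ p, ENNReal.ofReal ((z v p).2 i ^ (2 * 3)) ∂(μ.prod wienerPair) =
          ∫⁻ w, ENNReal.ofReal (w.2 i ^ (2 * 3)) ∂μ := h
      rw [h']
      have hmom := lintegral_momentum_pow_gibbsWeight_le hω hl.le hβ γ hT N i 3
      have h720 : (((2 * 3).factorial : ℕ) : ℝ) * T ^ 3 = 720 * T ^ 3 := by norm_num [Nat.factorial]
      rw [h720] at hmom
      exact hmom
    calc _ ≤ ENNReal.ofReal (720 * T ^ 3) * Z + ENNReal.ofReal (720 * T ^ 3) * Z := add_le_add (hst _) (hst _)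
      _ = ENNReal.ofReal (1440 * T ^ 3) * Z := by
          rw [← add_mul, ← ENNReal.ofReal_add (by positivity) (by positivity)]; ring_nf
  -- Tonelli for the three time-integrated terms
  obtain ⟨hL₂m, hL₂⟩ := lintegral_setLIntegral_le (ν := μ.prod wienerPair) hF₂m hE₂
  obtain ⟨hL₄m, hL₄⟩ := lintegral_setLIntegral_le (ν := μ.prod wienerPair) hF₄m hE₄
  obtain ⟨hL₅m, hL₅⟩ := lintegral_setLIntegral_le (ν := μ.prod wienerPair) hF₅m hE₅
  -- the pointwise bound, in `ℝ≥0∞` form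
  set a₁ : ℝ := 32768 * c ^ 6 with ha₁
  set a₂ : ℝ := 32768 * t₀ ^ 5 * c ^ 6 with ha₂
  set a₃ : ℝ := 1048576 * γ ^ 6 * t₀ ^ 5 * (1 + t₀ ^ 6) with ha₃
  have ha₁0 : 0 ≤ a₁ := by positivity
  have ha₂0 : 0 ≤ a₂ := by rw [ha₂]; exact mul_nonneg (mul_nonneg (by norm_num) (pow_nonneg ht0 5)) (by positivity)
  have ha₃0 : 0 ≤ a₃ := by
    rw [ha₃]; exact mul_nonneg (mul_nonneg (by positivity) (pow_nonneg ht0 5)) (by positivity)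
  have hs3 : 0 < s ^ 3 := pow_pos hs 3
  have hs6 : 0 < s ^ 6 := pow_pos hs 6
  have hpt : ∀ p : PhaseSpace N × WienerPair,
      ENNReal.ofReal (((∑ i, P.bondCurrent N i (z t p)) - ∑ i, P.bondCurrent N i (y t p)) ^ 2) ≤
        ENNReal.ofReal (s ^ 3 * 1216 / 3) * F₁ p +
        ENNReal.ofReal (s ^ 3 * t⁻¹ / 3) * (∫⁻ τ in Ioc 0 t, F₂ (τ, p)) +
        ENNReal.ofReal (a₁ / (3 * s ^ 6)) * F₃ p +
        ENNReal.ofReal (a₂ / (3 * s ^ 6)) * (∫⁻ u in Ioc 0 t, F₄ (u, p)) +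
        ENNReal.ofReal (a₃ / (3 * s ^ 6)) * (∫⁻ v in Ioc 0 t, F₅ (v, p)) := by
    intro p
    have h := sq_currentDiff_le_pointwise hω hl.le hβ hγ hN T p.1 p.2 ht htt hs hκ₁ hκ₂ hκ₃
    -- the real integrals of the right-hand side
    set I₂ : ℝ := ∫ τ in (0:ℝ)..t, Real.exp (6 * t₀ * (ω₂ + 4)) * (Ψ (z τ p) + Ψ (y τ p)) with hI₂
    set I₄ : ℝ := ∫ u in (0:ℝ)..t, (|brownian u.toNNReal p.2.1| ^ 6 + |brownian u.toNNReal p.2.2| ^ 6) with hI₄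
    set I₅ : ℝ := ∫ v in (0:ℝ)..t, ((z v p).2 ⟨0, hN⟩ ^ 6 + (z v p).2 ⟨N - 1, by omega⟩ ^ 6) with hI₅
    have hreal : ((∑ i, P.bondCurrent N i (z t p)) - ∑ i, P.bondCurrent N i (y t p)) ^ 2 ≤
        (s ^ 3 * (1216 * (Ψ (z t p) + Ψ (y t p))) + s ^ 3 * (t⁻¹ * I₂) +
          (a₁ * (|brownian t.toNNReal p.2.1| ^ 6 + |brownian t.toNNReal p.2.2| ^ 6) + a₂ * I₄ + a₃ * I₅) / s ^ 6) / 3 := h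
    have hI₂0 : 0 ≤ I₂ := intervalIntegral.integral_nonneg ht.le fun τ _ =>
      mul_nonneg (Real.exp_pos _).le (add_nonneg (hΨ0 _) (hΨ0 _))
    have hI₄0 : 0 ≤ I₄ := intervalIntegral.integral_nonneg ht.le fun u _ => by positivity
    have hI₅0 : 0 ≤ I₅ := intervalIntegral.integral_nonneg ht.le fun v _ => by positivity
    have hb0 : 0 ≤ |brownian t.toNNReal p.2.1| ^ 6 + |brownian t.toNNReal p.2.2| ^ 6 := by positivity
    have hΨz0 := hΨ0 (z t p)
    have hΨy0 := hΨ0 (y t p)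
    have hΨt0 : 0 ≤ Ψ (z t p) + Ψ (y t p) := add_nonneg hΨz0 hΨy0
    have hti0 : 0 ≤ t⁻¹ := inv_nonneg.2 ht.le
    -- conversions of the time integrals
    have hcI₂ : ENNReal.ofReal I₂ = ∫⁻ τ in Ioc 0 t, F₂ (τ, p) :=
      ofReal_intervalIntegral_eq (continuous_const.mul ((hΨc.comp (hzc p)).add (hΨc.comp (hyc p))))
        (fun τ => mul_nonneg (Real.exp_pos _).le (add_nonneg (hΨ0 _) (hΨ0 _))) ht.le
    have hb6 : ∀ u : ℝ, 0 ≤ |brownian u.toNNReal p.2.1| ^ 6 + |brownian u.toNNReal p.2.2| ^ 6 := fun u => by positivity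
    have hbc6 : Continuous fun u : ℝ => |brownian u.toNNReal p.2.1| ^ 6 + |brownian u.toNNReal p.2.2| ^ 6 :=
      ((hBc p).1.abs.pow 6).add ((hBc p).2.abs.pow 6)
    have hcI₄ : ENNReal.ofReal I₄ = ∫⁻ u in Ioc 0 t, F₄ (u, p) := ofReal_intervalIntegral_eq hbc6 hb6 ht.le
    have hk6 : ∀ v : ℝ, 0 ≤ (z v p).2 ⟨0, hN⟩ ^ 6 + (z v p).2 ⟨N - 1, by omega⟩ ^ 6 := fun v => by positivity
    have hkc6 : Continuous fun v : ℝ => (z v p).2 ⟨0, hN⟩ ^ 6 + (z v p).2 ⟨N - 1, by omega⟩ ^ 6 :=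
      (((continuous_apply _).comp (continuous_snd.comp (hzc p))).pow 6).add
        (((continuous_apply _).comp (continuous_snd.comp (hzc p))).pow 6)
    have hcI₅ : ENNReal.ofReal I₅ = ∫⁻ v in Ioc 0 t, F₅ (v, p) := ofReal_intervalIntegral_eq hkc6 hk6 ht.le
    -- rewrite the real bound as a sum of five nonnegative products
    have hreal' : ((∑ i, P.bondCurrent N i (z t p)) - ∑ i, P.bondCurrent N i (y t p)) ^ 2 ≤
        (s ^ 3 * 1216 / 3) * (Ψ (z t p) + Ψ (y t p)) + (s ^ 3 * t⁻¹ / 3) * I₂ +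
          (a₁ / (3 * s ^ 6)) * (|brownian t.toNNReal p.2.1| ^ 6 + |brownian t.toNNReal p.2.2| ^ 6) +
          (a₂ / (3 * s ^ 6)) * I₄ + (a₃ / (3 * s ^ 6)) * I₅ := by
      exact hreal.trans (le_of_eq (pointwise_coeff_rearrange s t _ _ I₂ _ I₄ I₅ a₁ a₂ a₃ hs.ne' ht.ne'))
    have hq1 : 0 ≤ s ^ 3 * 1216 / 3 := by positivity
    have hq2 : 0 ≤ s ^ 3 * t⁻¹ / 3 := by positivity
    have hq3 : 0 ≤ a₁ / (3 * s ^ 6) := div_nonneg ha₁0 (by positivity)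
    have hq4 : 0 ≤ a₂ / (3 * s ^ 6) := div_nonneg ha₂0 (by positivity)
    have hq5 : 0 ≤ a₃ / (3 * s ^ 6) := div_nonneg ha₃0 (by positivity)
    have n1 := mul_nonneg hq1 hΨt0
    have n2 := mul_nonneg hq2 hI₂0
    have n3 := mul_nonneg hq3 hb0
    have n4 := mul_nonneg hq4 hI₄0
    have n5 := mul_nonneg hq5 hI₅0
    refine (ENNReal.ofReal_le_ofReal hreal').trans (le_of_eq ?_)
    rw [ENNReal.ofReal_add (by linarith) n5, ENNReal.ofReal_add (by linarith) n4,
      ENNReal.ofReal_add (by linarith) n3, ENNReal.ofReal_add n1 n2,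
      ENNReal.ofReal_mul hq1, ENNReal.ofReal_mul hq2, ENNReal.ofReal_mul hq3,
      ENNReal.ofReal_mul hq4, ENNReal.ofReal_mul hq5, hcI₂, hcI₄, hcI₅]
  -- integrate
  have m1 : Measurable fun p => ENNReal.ofReal (s ^ 3 * 1216 / 3) * F₁ p := hF₁m.const_mul _
  have m2 : Measurable fun p => ENNReal.ofReal (s ^ 3 * t⁻¹ / 3) * (∫⁻ τ in Ioc 0 t, F₂ (τ, p)) := hL₂m.const_mul _
  have m3 : Measurable fun p => ENNReal.ofReal (a₁ / (3 * s ^ 6)) * F₃ p := hF₃m.const_mul _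
  have m4 : Measurable fun p => ENNReal.ofReal (a₂ / (3 * s ^ 6)) * (∫⁻ u in Ioc 0 t, F₄ (u, p)) := hL₄m.const_mul _
  have m12 : Measurable fun p => ENNReal.ofReal (s ^ 3 * 1216 / 3) * F₁ p +
      ENNReal.ofReal (s ^ 3 * t⁻¹ / 3) * (∫⁻ τ in Ioc 0 t, F₂ (τ, p)) := m1.add m2
  have m123 : Measurable fun p => ENNReal.ofReal (s ^ 3 * 1216 / 3) * F₁ p +
      ENNReal.ofReal (s ^ 3 * t⁻¹ / 3) * (∫⁻ τ in Ioc 0 t, F₂ (τ, p)) +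
      ENNReal.ofReal (a₁ / (3 * s ^ 6)) * F₃ p := m12.add m3
  have m1234 : Measurable fun p => ENNReal.ofReal (s ^ 3 * 1216 / 3) * F₁ p +
      ENNReal.ofReal (s ^ 3 * t⁻¹ / 3) * (∫⁻ τ in Ioc 0 t, F₂ (τ, p)) +
      ENNReal.ofReal (a₁ / (3 * s ^ 6)) * F₃ p +
      ENNReal.ofReal (a₂ / (3 * s ^ 6)) * (∫⁻ u in Ioc 0 t, F₄ (u, p)) := m123.add m4
  have hint : ∫⁻ p, (ENNReal.ofReal (s ^ 3 * 1216 / 3) * F₁ p +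
        ENNReal.ofReal (s ^ 3 * t⁻¹ / 3) * (∫⁻ τ in Ioc 0 t, F₂ (τ, p)) +
        ENNReal.ofReal (a₁ / (3 * s ^ 6)) * F₃ p +
        ENNReal.ofReal (a₂ / (3 * s ^ 6)) * (∫⁻ u in Ioc 0 t, F₄ (u, p)) +
        ENNReal.ofReal (a₃ / (3 * s ^ 6)) * (∫⁻ v in Ioc 0 t, F₅ (v, p))) ∂(μ.prod wienerPair) =
      ENNReal.ofReal (s ^ 3 * 1216 / 3) * ∫⁻ p, F₁ p ∂(μ.prod wienerPair) +
        ENNReal.ofReal (s ^ 3 * t⁻¹ / 3) * ∫⁻ p, (∫⁻ τ in Ioc 0 t, F₂ (τ, p)) ∂(μ.prod wienerPair) +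
        ENNReal.ofReal (a₁ / (3 * s ^ 6)) * ∫⁻ p, F₃ p ∂(μ.prod wienerPair) +
        ENNReal.ofReal (a₂ / (3 * s ^ 6)) * ∫⁻ p, (∫⁻ u in Ioc 0 t, F₄ (u, p)) ∂(μ.prod wienerPair) +
        ENNReal.ofReal (a₃ / (3 * s ^ 6)) * ∫⁻ p, (∫⁻ v in Ioc 0 t, F₅ (v, p)) ∂(μ.prod wienerPair) := by
    rw [lintegral_add_left m1234, lintegral_add_left m123, lintegral_add_left m12, lintegral_add_left m1,
      lintegral_const_mul _ hF₁m, lintegral_const_mul _ hL₂m, lintegral_const_mul _ hF₃m,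
      lintegral_const_mul _ hL₄m, lintegral_const_mul _ hL₅m]
  -- combine the constants
  have step1 : ∫⁻ p, ENNReal.ofReal (((∑ i, P.bondCurrent N i (z t p)) - ∑ i, P.bondCurrent N i (y t p)) ^ 2)
      ∂(μ.prod wienerPair) ≤
      ENNReal.ofReal (s ^ 3 * 1216 / 3) * (IΨ + IΨ) +
        ENNReal.ofReal (s ^ 3 * t⁻¹ / 3) *
          (ENNReal.ofReal (Real.exp (6 * t₀ * (ω₂ + 4))) * (IΨ + IΨ) * ENNReal.ofReal t) +
        ENNReal.ofReal (a₁ / (3 * s ^ 6)) * (ENNReal.ofReal (2880 * Real.exp (t₀ / 2)) * Z) +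
        ENNReal.ofReal (a₂ / (3 * s ^ 6)) * (ENNReal.ofReal (2880 * Real.exp (t₀ / 2)) * Z * ENNReal.ofReal t) +
        ENNReal.ofReal (a₃ / (3 * s ^ 6)) * (ENNReal.ofReal (1440 * T ^ 3) * Z * ENNReal.ofReal t) := by
    refine (lintegral_mono hpt).trans ?_
    rw [hint, hE₁]
    exact add_le_add (add_le_add (add_le_add (add_le_add le_rfl (mul_le_mul_right hL₂ _))
      (mul_le_mul_right hE₃ _)) (mul_le_mul_right hL₄ _)) (mul_le_mul_right hL₅ _)
  refine step1.trans ?_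
  have hIΨ2 : IΨ + IΨ = ENNReal.ofReal 2 * IΨ := by rw [ENNReal.ofReal_ofNat, two_mul]
  rw [hIΨ2]
  have hq1 : 0 ≤ s ^ 3 * 1216 / 3 := by positivity
  have hq2 : 0 ≤ s ^ 3 * t⁻¹ / 3 := by have := inv_nonneg.2 ht.le; positivity
  have hq3 : 0 ≤ a₁ / (3 * s ^ 6) := div_nonneg ha₁0 (by positivity)
  have hq4 : 0 ≤ a₂ / (3 * s ^ 6) := div_nonneg ha₂0 (by positivity)
  have hq5 : 0 ≤ a₃ / (3 * s ^ 6) := div_nonneg ha₃0 (by positivity)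
  have he0 : 0 ≤ Real.exp (6 * t₀ * (ω₂ + 4)) := (Real.exp_pos _).le
  have hm0 : 0 ≤ 2880 * Real.exp (t₀ / 2) := by positivity
  have hk0 : 0 ≤ 1440 * T ^ 3 := by positivity
  -- the `IΨ` part
  have hΨpart : ENNReal.ofReal (s ^ 3 * 1216 / 3) * (ENNReal.ofReal 2 * IΨ) +
      ENNReal.ofReal (s ^ 3 * t⁻¹ / 3) *
        (ENNReal.ofReal (Real.exp (6 * t₀ * (ω₂ + 4))) * (ENNReal.ofReal 2 * IΨ) * ENNReal.ofReal t) =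
      ENNReal.ofReal (s ^ 3 * ((2 * 1216 + 2 * Real.exp (6 * t₀ * (ω₂ + 4))) / 3)) * IΨ := by
    have e1 : ENNReal.ofReal (Real.exp (6 * t₀ * (ω₂ + 4))) * (ENNReal.ofReal 2 * IΨ) * ENNReal.ofReal t =
        ENNReal.ofReal (Real.exp (6 * t₀ * (ω₂ + 4)) * 2 * t) * IΨ := by
      rw [ENNReal.ofReal_mul (by positivity), ENNReal.ofReal_mul he0]; ring
    rw [e1, ofReal_mul_ofReal_mul IΨ hq1, ofReal_mul_ofReal_mul IΨ hq2,
      ofReal_mul_add_ofReal_mul IΨ (by positivity) (mul_nonneg hq2 (by positivity)),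
      psi_coeff_sum s t _ ht.ne']
  -- the `Z` part
  have hZpart : ENNReal.ofReal (a₁ / (3 * s ^ 6)) * (ENNReal.ofReal (2880 * Real.exp (t₀ / 2)) * Z) +
      ENNReal.ofReal (a₂ / (3 * s ^ 6)) * (ENNReal.ofReal (2880 * Real.exp (t₀ / 2)) * Z * ENNReal.ofReal t) +
      ENNReal.ofReal (a₃ / (3 * s ^ 6)) * (ENNReal.ofReal (1440 * T ^ 3) * Z * ENNReal.ofReal t) ≤
      ENNReal.ofReal (((32768 * (Real.sqrt (2 * (pinnedChain ω₂ lam β γ).γ * T)) ^ 6 * (2880 * Real.exp (t₀ / 2)) + 32768 * t₀ ^ 5 * (Real.sqrt (2 * (pinnedChain ω₂ lam β γ).γ * T)) ^ 6 * ((2880 * Real.exp (t₀ / 2)) * t₀) +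
          1048576 * γ ^ 6 * t₀ ^ 5 * (1 + t₀ ^ 6) * (1440 * T ^ 3 * t₀)) / 3) / s ^ 6) * Z := by
    rw [ofReal_mul_ofReal_mul Z hq3, ofReal_mul_ofReal_mul_ofReal Z hq4 hm0, ofReal_mul_ofReal_mul_ofReal Z hq5 hk0,
      ofReal_mul_add_ofReal_mul Z (mul_nonneg hq3 hm0) (mul_nonneg hq4 (by positivity)),
      ofReal_mul_add_ofReal_mul Z (add_nonneg (mul_nonneg hq3 hm0) (mul_nonneg hq4 (by positivity)))
        (mul_nonneg hq5 (by positivity))]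
    refine mul_le_mul_left (ENNReal.ofReal_le_ofReal ?_) _
    have h := z_coeff_sum_le (c := c) (m := 2880 * Real.exp (t₀ / 2)) (k := 1440 * T ^ 3) (γ := γ) hs ht.le htt hm0 hk0
    rw [ha₁, ha₂, ha₃]
    exact h
  calc _ = (ENNReal.ofReal (s ^ 3 * 1216 / 3) * (ENNReal.ofReal 2 * IΨ) +
        ENNReal.ofReal (s ^ 3 * t⁻¹ / 3) *
          (ENNReal.ofReal (Real.exp (6 * t₀ * (ω₂ + 4))) * (ENNReal.ofReal 2 * IΨ) * ENNReal.ofReal t)) +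
        (ENNReal.ofReal (a₁ / (3 * s ^ 6)) * (ENNReal.ofReal (2880 * Real.exp (t₀ / 2)) * Z) +
          ENNReal.ofReal (a₂ / (3 * s ^ 6)) * (ENNReal.ofReal (2880 * Real.exp (t₀ / 2)) * Z * ENNReal.ofReal t) +
          ENNReal.ofReal (a₃ / (3 * s ^ 6)) * (ENNReal.ofReal (1440 * T ^ 3) * Z * ENNReal.ofReal t)) := by
        simp only [add_assoc]
    _ ≤ _ := by rw [hΨpart]; exact add_le_add le_rfl hZpart

end Expectation

end Summit.AtomisticToContinuum.FouriersLaw.Theorems.OddCorrectorBathLocality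

end
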